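import Summits.KontsevichZagierPeriods.Zeta5Search.Barrier.ConeGammaCuspWeightBound

/-!
# ζ(5) search — BARRIER: GREEDY WEIGHTS OF A PATTERN FUNCTION — the finite combinatorics of the Lovász extension

HONEST FRAMING (cell `pub-zeta5`): systematic search; no irrationality claim unless kernel-certified. MODEL objects
under Brown–Zudilin's (28)+(30) accounting ([BZ22] = arXiv:2210.03391; (28) observed, not proved); nothing here is a
statement about `ζ(5)`, any `γ` of record, the cone's supremum (C2 OPEN) or the value / sign / modularity type of any
junction at a named direction (DATA of the cell); S-E stays CONJECTURED; records in print UNMOVED. Prover P2 g30, item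
«THE JUNCTION VOTE IS A LOVÁSZ EXTENSION» (INBOX 2026-08-27), file (3a): PURE finite combinatorics (no saving function,
no integral) — the greedy/Abel calculus behind Lovász's theorem «the extension of a set function is convex iff the
function is submodular» (L. Lovász 1983; J. Edmonds 1970), in the shape the junction theorems of file (3b) consume.

Data: a finset `M ⊆ Fin 28` (the members of a junction), a set function `f : Finset (Fin 28) → ℝ` (the pattern
saving), rates `ρ : Fin 28 → ℝ` of a reference displacement that are pairwise distinct on `M` («generic»), with
PREFIX SETS `P≤(k) = {l ∈ M : ρ k ≤ ρ l}`, `P<(k) = {l ∈ M : ρ k < ρ l}` and GREEDY WEIGHTS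
`w_k = f(P≤(k)) − f(P<(k))`; flip times `c : Fin 28 → ℝ` of a second displacement and a strict chain `d_0 < ⋯ < d_n`
through them with THRESHOLD SETS `S_i = {k ∈ M : c_k ≤ d_i}`.
* `sum_mul_eq_sum_chain_jumps` — regrouping `Σ_{k∈M} w_k c_k = Σ_i d_i (w(S_i) − w(S_{i−1}))`;
* `abel_range`, `sum_Ico_mul_sub_nonpos` — Abel summation and the sign of `Σ_i d_i (X_i − X_{i−1})` for a monotone
  chain and `X ≥ 0` vanishing at both ends;
* `prefix_le_eq_insert`, `greedy_sum_prefix`, **`greedy_sum_eq`** — `Σ_{k∈M} w_k = f(M) − f(∅)` (telescoping);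
* **`greedy_sum_le_of_submodular`** — `Σ_{k∈Q} w_k ≤ f(Q) − f(∅)` for every `Q ⊆ M` when `f` is SUBMODULAR on the
  subsets of `M` (the greedy vector lies in the base polytope);
* **`greedy_le_lovasz_of_submodular`** — `Σ_{k∈M} w_k·(−c_k) ≤ −Σ_i d_i (f(S_i) − f(S_{i−1}))`: the greedy functional
  of the reference order under-estimates the Lovász (Choquet) value at every other point;
  `lovasz_le_greedy_of_supermodular` (the mirror); **`greedy_eq_lovasz_of_prefix`** — EQUALITY, for any `f`, as
  soon as every threshold set `S_i` is empty or a prefix set of `ρ` (the closed chamber of the reference order).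
NOT here: anything about `γ`, C2, S-E, `ζ(5)`, or any named direction.
-/

noncomputable section

open Finset

namespace Summit.KontsevichZagierPeriods.Zeta5Search.Barrier.ConeGamma

/-! ### Regrouping a weighted sum along a strict chain -/

/-- **Regrouping along a chain.** If every `c_k` (`k ∈ M`) is a point `d_i` (`0 < i < n`) of the strict chain `d`,
then `Σ_{k∈M} w_k c_k = Σ_{0<i<n} d_i·(w(S_i) − w(S_{i−1}))` with `S_i = {k ∈ M : c_k ≤ d_i}`. -/
theorem sum_mul_eq_sum_chain_jumps (M : Finset (Fin 28)) (w c : Fin 28 → ℝ) {n : ℕ} {d : ℕ → ℝ}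
    (hmono : ∀ j < n, d j < d (j + 1)) (hflip : ∀ k ∈ M, ∃ i, 0 < i ∧ i < n ∧ d i = c k) :
    ∑ k ∈ M, w k * c k = ∑ i ∈ Finset.Ico 1 n, d i *
      (∑ k ∈ M.filter (fun k => c k ≤ d i), w k - ∑ k ∈ M.filter (fun k => c k ≤ d (i - 1)), w k) := by
  classical
  -- the chain index of each member
  obtain ⟨ι, hι⟩ : ∃ ι : Fin 28 → ℕ, ∀ k ∈ M, 0 < ι k ∧ ι k < n ∧ d (ι k) = c k :=
    ⟨fun k => if h : k ∈ M then (hflip k h).choose else 0, fun k hk => by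
      simp only [dif_pos hk]; exact (hflip k hk).choose_spec⟩
  have hsm : StrictMonoOn d (Set.Iic n) := by
    intro i hi j hj hij
    induction j with
    | zero => exact absurd hij (Nat.not_lt_zero _)
    | succ m ih =>
      rcases Nat.lt_succ_iff_lt_or_eq.mp hij with h | h
      · exact (ih (le_trans (Nat.le_succ m) hj) h).trans (hmono m (Nat.lt_of_succ_le hj))
      · rw [h]; exact hmono m (Nat.lt_of_succ_le hj)
  -- the jump of the threshold sums at `d_i` collects exactly the members with `c_k = d_i`
  have hjump : ∀ i ∈ Finset.Ico 1 n,
      ∑ k ∈ M.filter (fun k => c k ≤ d i), w k - ∑ k ∈ M.filter (fun k => c k ≤ d (i - 1)), w k =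
        ∑ k ∈ M.filter (fun k => ι k = i), w k := by
    intro i hi
    obtain ⟨hi1, hin⟩ := Finset.mem_Ico.mp hi
    have hsub : M.filter (fun k => c k ≤ d (i - 1)) ⊆ M.filter (fun k => c k ≤ d i) := by
      intro k hk
      obtain ⟨hkM, hkc⟩ := Finset.mem_filter.mp hk
      refine Finset.mem_filter.mpr ⟨hkM, hkc.trans ?_⟩
      have := hmono (i - 1) (by omega)
      rw [Nat.sub_add_cancel hi1] at this
      exact this.le
    rw [← Finset.sum_sdiff hsub, add_sub_cancel_right]
    refine Finset.sum_congr ?_ fun _ _ => rfl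
    ext k
    simp only [Finset.mem_sdiff, Finset.mem_filter, not_and, not_le]
    constructor
    · rintro ⟨⟨hkM, hle⟩, hgt⟩
      obtain ⟨h0, hlt, hd⟩ := hι k hkM
      refine ⟨hkM, ?_⟩
      have hgt' := hgt hkM
      rw [← hd] at hle hgt'
      -- `d (i-1) < d (ι k) ≤ d i` forces `ι k = i`
      by_contra hne
      rcases lt_or_gt_of_ne hne with h | h
      · have : ι k ≤ i - 1 := by omega
        rcases this.eq_or_lt with h' | h'
        · rw [h'] at hgt'; exact lt_irrefl _ hgt'
        · exact absurd (hsm (show ι k ∈ Set.Iic n from hlt.le) (show i - 1 ∈ Set.Iic n by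
            simp only [Set.mem_Iic]; omega) h') (not_lt.mpr hgt'.le)
      · exact absurd (hsm (show i ∈ Set.Iic n from hin.le) (show ι k ∈ Set.Iic n from hlt.le) h) (not_lt.mpr hle)
    · rintro ⟨hkM, hιk⟩
      obtain ⟨h0, hlt, hd⟩ := hι k hkM
      rw [hιk] at hd
      refine ⟨⟨hkM, hd.symm.le⟩, fun _ => ?_⟩
      rw [← hd]
      have := hmono (i - 1) (by omega)
      rwa [Nat.sub_add_cancel hi1] at this
  rw [show (∑ i ∈ Finset.Ico 1 n, d i *
      (∑ k ∈ M.filter (fun k => c k ≤ d i), w k - ∑ k ∈ M.filter (fun k => c k ≤ d (i - 1)), w k)) =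
      ∑ i ∈ Finset.Ico 1 n, d i * ∑ k ∈ M.filter (fun k => ι k = i), w k from
    Finset.sum_congr rfl fun i hi => by rw [hjump i hi]]
  -- fibrewise: every member sits in exactly one fibre `ι k = i`, `i ∈ Ico 1 n`
  have hmaps : ∀ k ∈ M, ι k ∈ Finset.Ico 1 n := fun k hk => by
    obtain ⟨h0, hlt, -⟩ := hι k hk
    exact Finset.mem_Ico.mpr ⟨h0, hlt⟩
  rw [← Finset.sum_fiberwise_of_maps_to hmaps (fun k => w k * c k)]
  refine Finset.sum_congr rfl fun i _ => ?_
  rw [Finset.mul_sum]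
  refine Finset.sum_congr rfl fun k hk => ?_
  obtain ⟨hkM, hιk⟩ := Finset.mem_filter.mp hk
  rw [← (hι k hkM).2.2, hιk, mul_comm]

/-! ### Abel summation and a sign lemma -/

/-- Abel summation on a range: `Σ_{i<n} m_{i+1}(X_{i+1} − X_i) = m_n X_n − m_0 X_0 − Σ_{i<n} (m_{i+1} − m_i) X_i`. -/
theorem abel_range (m X : ℕ → ℝ) (n : ℕ) :
    ∑ i ∈ Finset.range n, m (i + 1) * (X (i + 1) - X i) =
      m n * X n - m 0 * X 0 - ∑ i ∈ Finset.range n, (m (i + 1) - m i) * X i := by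
  induction n with
  | zero => simp
  | succ n ih => rw [Finset.sum_range_succ, Finset.sum_range_succ, ih]; ring

/-- **Sign of an Abel sum.** For a weakly increasing chain `m` and `X ≥ 0` with `X_0 = X_{n−1} = 0`:
`Σ_{0<i<n} m_i (X_i − X_{i−1}) ≤ 0`. -/
theorem sum_Ico_mul_sub_nonpos {m X : ℕ → ℝ} {n : ℕ} (hn : 0 < n) (hX0 : X 0 = 0) (hXn : X (n - 1) = 0)
    (hmono : ∀ j, j + 1 < n → m j ≤ m (j + 1)) (hX : ∀ j, j < n → 0 ≤ X j) :
    ∑ i ∈ Finset.Ico 1 n, m i * (X i - X (i - 1)) ≤ 0 := by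
  rw [Finset.sum_Ico_eq_sum_range,
    Finset.sum_congr rfl fun k _ => by rw [Nat.add_sub_cancel_left, Nat.add_comm 1 k], abel_range, hX0,
    mul_zero, sub_zero, hXn, mul_zero, zero_sub, neg_nonpos]

  exact Finset.sum_nonneg fun j hj => mul_nonneg (sub_nonneg.mpr (hmono j (by
    have := Finset.mem_range.mp hj; omega))) (hX j (by have := Finset.mem_range.mp hj; omega))


/-! ### Prefix sets and greedy weights of a generic order -/

/-- For rates `ρ` pairwise distinct on `M` and `k ∈ M`: `P≤(k) = insert k P<(k)` and `k ∉ P<(k)`. -/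
theorem prefix_le_eq_insert {M : Finset (Fin 28)} {ρ : Fin 28 → ℝ}
    (hgen : ∀ k ∈ M, ∀ l ∈ M, k ≠ l → ρ k ≠ ρ l) {k : Fin 28} (hk : k ∈ M) :
    M.filter (fun l => ρ k ≤ ρ l) = insert k (M.filter fun l => ρ k < ρ l) ∧
      k ∉ M.filter (fun l => ρ k < ρ l) := by
  refine ⟨?_, fun h => lt_irrefl _ (Finset.mem_filter.mp h).2⟩
  ext l
  simp only [Finset.mem_filter, Finset.mem_insert]
  constructor
  · rintro ⟨hl, hle⟩
    by_cases hkl : l = k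
    · exact Or.inl hkl
    · exact Or.inr ⟨hl, lt_of_le_of_ne hle (hgen k hk l hl (Ne.symm hkl))⟩
  · rintro (rfl | ⟨hl, hlt⟩)
    · exact ⟨hk, le_rfl⟩
    · exact ⟨hl, hlt.le⟩

/-- **Telescoping on prefix sets**: for every `t ∈ M`, `Σ_{k ∈ P≤(t)} w_k = f(P≤(t)) − f(∅)`. -/
theorem greedy_sum_prefix {M : Finset (Fin 28)} {ρ : Fin 28 → ℝ} (f : Finset (Fin 28) → ℝ)
    (hgen : ∀ k ∈ M, ∀ l ∈ M, k ≠ l → ρ k ≠ ρ l) :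
    ∀ t ∈ M, ∑ k ∈ M.filter (fun l => ρ t ≤ ρ l),
        (f (M.filter fun l => ρ k ≤ ρ l) - f (M.filter fun l => ρ k < ρ l)) =
      f (M.filter fun l => ρ t ≤ ρ l) - f ∅ := by
  classical
  -- strong induction on the size of the prefix set
  suffices h : ∀ n : ℕ, ∀ t ∈ M, (M.filter fun l => ρ t ≤ ρ l).card ≤ n →
      ∑ k ∈ M.filter (fun l => ρ t ≤ ρ l),
          (f (M.filter fun l => ρ k ≤ ρ l) - f (M.filter fun l => ρ k < ρ l)) =
        f (M.filter fun l => ρ t ≤ ρ l) - f ∅ from fun t ht => h _ t ht le_rfl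
  intro n
  induction n with
  | zero =>
    intro t ht hcard
    have : t ∈ M.filter (fun l => ρ t ≤ ρ l) := Finset.mem_filter.mpr ⟨ht, le_rfl⟩
    rw [Finset.card_eq_zero.mp (Nat.le_zero.mp hcard)] at this
    exact absurd this (Finset.notMem_empty _)
  | succ n ih =>
    intro t ht hcard
    obtain ⟨hins, hnot⟩ := prefix_le_eq_insert hgen ht
    rw [hins, Finset.sum_insert hnot]
    by_cases hemp : M.filter (fun l => ρ t < ρ l) = ∅
    · rw [hemp, Finset.sum_empty, add_zero, hins, hemp]
    · -- the later prefix set is the prefix set of its earliest member `t'`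
      obtain ⟨t', ht', hmin⟩ := Finset.exists_min_image _ ρ (Finset.nonempty_iff_ne_empty.mpr hemp)
      obtain ⟨ht'M, htt'⟩ := Finset.mem_filter.mp ht'
      have heq : M.filter (fun l => ρ t < ρ l) = M.filter (fun l => ρ t' ≤ ρ l) := by
        ext l
        simp only [Finset.mem_filter]
        constructor
        · rintro ⟨hl, hlt⟩; exact ⟨hl, hmin l (Finset.mem_filter.mpr ⟨hl, hlt⟩)⟩
        · rintro ⟨hl, hle⟩; exact ⟨hl, htt'.trans_le hle⟩
      have hcard' : (M.filter fun l => ρ t' ≤ ρ l).card ≤ n := by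
        have hlt : (M.filter fun l => ρ t < ρ l).card < (M.filter fun l => ρ t ≤ ρ l).card := by
          rw [hins, Finset.card_insert_of_notMem hnot]; exact Nat.lt_succ_self _
        rw [← heq]; omega
      rw [heq, ih t' ht'M hcard', ← heq, ← hins]
      ring

/-- **The greedy weights add up to `f(M) − f(∅)`.** -/
theorem greedy_sum_eq {M : Finset (Fin 28)} {ρ : Fin 28 → ℝ} (f : Finset (Fin 28) → ℝ)
    (hgen : ∀ k ∈ M, ∀ l ∈ M, k ≠ l → ρ k ≠ ρ l) :
    ∑ k ∈ M, (f (M.filter fun l => ρ k ≤ ρ l) - f (M.filter fun l => ρ k < ρ l)) = f M - f ∅ := by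
  classical
  rcases M.eq_empty_or_nonempty with hM | hM
  · simp [hM]
  · obtain ⟨t, ht, hmin⟩ := Finset.exists_min_image M ρ hM
    have hall : M.filter (fun l => ρ t ≤ ρ l) = M := by
      ext l
      simp only [Finset.mem_filter, and_iff_left_iff_imp]
      exact hmin l
    have h := greedy_sum_prefix f hgen t ht
    rwa [hall] at h

/-- **The greedy vector lies in the base polytope of a SUBMODULAR function**: `Σ_{k∈Q} w_k ≤ f(Q) − f(∅)` for every
`Q ⊆ M` (remove the latest-flipping member `t` of `Q`: `Q ∖ t ⊆ P<(t)`, `Q ⊆ P≤(t)`, and submodularity at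
`P<(t), Q` bounds `w_t` by `f(Q) − f(Q ∖ t)`). -/
theorem greedy_sum_le_of_submodular {M : Finset (Fin 28)} {ρ : Fin 28 → ℝ} {f : Finset (Fin 28) → ℝ}
    (hgen : ∀ k ∈ M, ∀ l ∈ M, k ≠ l → ρ k ≠ ρ l)
    (hsub : ∀ A B : Finset (Fin 28), A ⊆ M → B ⊆ M → f (A ∪ B) + f (A ∩ B) ≤ f A + f B) :
    ∀ Q : Finset (Fin 28), Q ⊆ M →
      ∑ k ∈ Q, (f (M.filter fun l => ρ k ≤ ρ l) - f (M.filter fun l => ρ k < ρ l)) ≤ f Q - f ∅ := by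
  classical
  suffices h : ∀ n : ℕ, ∀ Q : Finset (Fin 28), Q ⊆ M → Q.card ≤ n →
      ∑ k ∈ Q, (f (M.filter fun l => ρ k ≤ ρ l) - f (M.filter fun l => ρ k < ρ l)) ≤ f Q - f ∅ from
    fun Q hQ => h _ Q hQ le_rfl
  intro n
  induction n with
  | zero =>
    intro Q _ hcard
    rw [Finset.card_eq_zero.mp (Nat.le_zero.mp hcard)]; simp
  | succ n ih =>
    intro Q hQ hcard
    rcases Q.eq_empty_or_nonempty with hQe | hQne
    · rw [hQe]; simp
    obtain ⟨t, ht, hmin⟩ := Finset.exists_min_image Q ρ hQne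
    have htM : t ∈ M := hQ ht
    -- `P<(t) ∪ Q = P≤(t)` and `P<(t) ∩ Q = Q.erase t`
    have hU : M.filter (fun l => ρ t < ρ l) ∪ Q = M.filter (fun l => ρ t ≤ ρ l) := by
      ext l
      simp only [Finset.mem_union, Finset.mem_filter]
      constructor
      · rintro (⟨hl, hlt⟩ | hl)
        · exact ⟨hl, hlt.le⟩
        · exact ⟨hQ hl, hmin l hl⟩
      · rintro ⟨hl, hle⟩
        by_cases hlt' : l = t
        · exact Or.inr (hlt' ▸ ht)
        · exact Or.inl ⟨hl, lt_of_le_of_ne hle (hgen t htM l hl (Ne.symm hlt'))⟩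
    have hI : M.filter (fun l => ρ t < ρ l) ∩ Q = Q.erase t := by
      ext l
      simp only [Finset.mem_inter, Finset.mem_filter, Finset.mem_erase]
      constructor
      · rintro ⟨⟨-, hlt⟩, hl⟩; exact ⟨fun h => lt_irrefl _ (h ▸ hlt), hl⟩
      · rintro ⟨hne, hl⟩; exact ⟨⟨hQ hl, lt_of_le_of_ne (hmin l hl) (hgen t htM l (hQ hl) (Ne.symm hne))⟩, hl⟩
    have hsm := hsub (M.filter fun l => ρ t < ρ l) Q (Finset.filter_subset _ _) hQ
    rw [hU, hI] at hsm
    have hIH := ih (Q.erase t) ((Finset.erase_subset _ _).trans hQ)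
      (by rw [Finset.card_erase_of_mem ht]; omega)
    rw [← Finset.add_sum_erase Q _ ht]
    linarith

/-! ### Domination and the chamber equality -/

/-- **GREEDY ≤ LOVÁSZ (submodular case).** Let `ρ` be pairwise distinct on `M`, `f` submodular on the subsets of
`M`, and let the strict chain `d_0 < ⋯ < d_n` pass through every `c_k` (`k ∈ M`) at an interior index. Then the greedy
functional of the order `ρ` at the point `−c` is at most the Lovász (Choquet) value along the chain of `c`:
`Σ_{k∈M} w_k·(−c_k) ≤ −Σ_{0<i<n} d_i·(f(S_i) − f(S_{i−1}))`, `S_i = {k ∈ M : c_k ≤ d_i}`. -/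
theorem greedy_le_lovasz_of_submodular {M : Finset (Fin 28)} {ρ : Fin 28 → ℝ} {f : Finset (Fin 28) → ℝ}
    (hgen : ∀ k ∈ M, ∀ l ∈ M, k ≠ l → ρ k ≠ ρ l)
    (hsub : ∀ A B : Finset (Fin 28), A ⊆ M → B ⊆ M → f (A ∪ B) + f (A ∩ B) ≤ f A + f B)
    (c : Fin 28 → ℝ) {n : ℕ} {d : ℕ → ℝ} (hmono : ∀ j < n, d j < d (j + 1))
    (hflip : ∀ k ∈ M, ∃ i, 0 < i ∧ i < n ∧ d i = c k) :
    ∑ k ∈ M, (f (M.filter fun l => ρ k ≤ ρ l) - f (M.filter fun l => ρ k < ρ l)) * (-c k) ≤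
      -∑ i ∈ Finset.Ico 1 n, d i *
        (f (M.filter fun k => c k ≤ d i) - f (M.filter fun k => c k ≤ d (i - 1))) := by
  classical
  rcases Nat.eq_zero_or_pos n with hn | hn
  · subst hn
    have hM : M = ∅ := Finset.eq_empty_of_forall_notMem fun k hk => by
      obtain ⟨i, -, hi, -⟩ := hflip k hk; exact absurd hi (Nat.not_lt_zero _)
    simp [hM]
  -- shorthand
  obtain ⟨w, hw⟩ : ∃ w : Fin 28 → ℝ, ∀ k,
      w k = f (M.filter fun l => ρ k ≤ ρ l) - f (M.filter fun l => ρ k < ρ l) := ⟨_, fun _ => rfl⟩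
  obtain ⟨S, hS⟩ : ∃ S : ℕ → Finset (Fin 28), ∀ i, S i = M.filter fun k => c k ≤ d i := ⟨_, fun _ => rfl⟩
  simp only [← hw, ← hS]
  have hSsub : ∀ i, S i ⊆ M := fun i => by rw [hS]; exact Finset.filter_subset _ _
  have hS0 : S 0 = ∅ := by
    rw [hS]
    refine Finset.eq_empty_of_forall_notMem fun k hk => ?_
    obtain ⟨hkM, hle⟩ := Finset.mem_filter.mp hk
    obtain ⟨i, hi0, hin, hdi⟩ := hflip k hkM
    have : d 0 < d i := chain_strictMono hmono hi0 hin.le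
    linarith
  have hSn : S (n - 1) = M := by
    rw [hS]
    ext k
    simp only [Finset.mem_filter, and_iff_left_iff_imp]
    intro hkM
    obtain ⟨i, hi0, hin, hdi⟩ := hflip k hkM
    rw [← hdi]
    exact chain_mono hmono (by omega : i ≤ n - 1) (by omega : n - 1 ≤ n)
  -- regroup the greedy side along the chain
  have hre := sum_mul_eq_sum_chain_jumps M w c hmono hflip
  simp only [← hS] at hre
  have hneg : ∑ k ∈ M, w k * -c k = -∑ i ∈ Finset.Ico 1 n, d i * (∑ k ∈ S i, w k - ∑ k ∈ S (i - 1), w k) := by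
    rw [← hre, ← Finset.sum_neg_distrib]
    exact Finset.sum_congr rfl fun k _ => by ring
  rw [hneg, neg_le_neg_iff]
  -- Abel with `Z_i = f(S_i) − f(∅) − w(S_i) ≥ 0`, vanishing at both ends
  have key := sum_Ico_mul_sub_nonpos (m := d) (X := fun i => f (S i) - f ∅ - ∑ k ∈ S i, w k) hn
    (by simp only [hS0, Finset.sum_empty, sub_self])
    (by simp only [hSn, hw]; rw [greedy_sum_eq f hgen]; ring)
    (fun j hj => (hmono j (by omega)).le)
    (fun j _ => by
      have := greedy_sum_le_of_submodular hgen hsub (S j) (hSsub j)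
      simp only [← hw] at this
      linarith)
  have hsplit : ∑ i ∈ Finset.Ico 1 n, d i *
      ((f (S i) - f ∅ - ∑ k ∈ S i, w k) - (f (S (i - 1)) - f ∅ - ∑ k ∈ S (i - 1), w k)) =
      ∑ i ∈ Finset.Ico 1 n, d i * (f (S i) - f (S (i - 1))) -
        ∑ i ∈ Finset.Ico 1 n, d i * (∑ k ∈ S i, w k - ∑ k ∈ S (i - 1), w k) := by
    rw [← Finset.sum_sub_distrib]
    exact Finset.sum_congr rfl fun i _ => by ring
  linarith

/-- **LOVÁSZ ≤ GREEDY (supermodular case)** — the mirror of `greedy_le_lovasz_of_submodular` (`f ↦ −f`). -/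
theorem lovasz_le_greedy_of_supermodular {M : Finset (Fin 28)} {ρ : Fin 28 → ℝ} {f : Finset (Fin 28) → ℝ}
    (hgen : ∀ k ∈ M, ∀ l ∈ M, k ≠ l → ρ k ≠ ρ l)
    (hsuper : ∀ A B : Finset (Fin 28), A ⊆ M → B ⊆ M → f A + f B ≤ f (A ∪ B) + f (A ∩ B))
    (c : Fin 28 → ℝ) {n : ℕ} {d : ℕ → ℝ} (hmono : ∀ j < n, d j < d (j + 1))
    (hflip : ∀ k ∈ M, ∃ i, 0 < i ∧ i < n ∧ d i = c k) :
    -∑ i ∈ Finset.Ico 1 n, d i *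
        (f (M.filter fun k => c k ≤ d i) - f (M.filter fun k => c k ≤ d (i - 1))) ≤
      ∑ k ∈ M, (f (M.filter fun l => ρ k ≤ ρ l) - f (M.filter fun l => ρ k < ρ l)) * (-c k) := by
  have h := greedy_le_lovasz_of_submodular (f := fun A => -f A) hgen
    (fun A B hA hB => by linarith [hsuper A B hA hB]) c hmono hflip
  have e1 : ∑ k ∈ M, (-f (M.filter fun l => ρ k ≤ ρ l) - -f (M.filter fun l => ρ k < ρ l)) * -c k =
      -∑ k ∈ M, (f (M.filter fun l => ρ k ≤ ρ l) - f (M.filter fun l => ρ k < ρ l)) * -c k := by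
    rw [← Finset.sum_neg_distrib]; exact Finset.sum_congr rfl fun k _ => by ring
  have e2 : ∑ i ∈ Finset.Ico 1 n, d i *
      (-f (M.filter fun k => c k ≤ d i) - -f (M.filter fun k => c k ≤ d (i - 1))) =
      -∑ i ∈ Finset.Ico 1 n, d i *
        (f (M.filter fun k => c k ≤ d i) - f (M.filter fun k => c k ≤ d (i - 1))) := by
    rw [← Finset.sum_neg_distrib]; exact Finset.sum_congr rfl fun i _ => by ring
  rw [e1, e2] at h
  linarith

/-- **GREEDY = LOVÁSZ on the closed chamber.** With `ρ` pairwise distinct on `M` and ANY `f`: if every threshold set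
`S_i` (`i < n`) of the chain of `c` is empty or a prefix set `P≤(t)` of `ρ` (the order of `c` on `M` is refined by
the order of `ρ`), the greedy functional EQUALS the Lovász value. -/
theorem greedy_eq_lovasz_of_prefix {M : Finset (Fin 28)} {ρ : Fin 28 → ℝ} (f : Finset (Fin 28) → ℝ)
    (hgen : ∀ k ∈ M, ∀ l ∈ M, k ≠ l → ρ k ≠ ρ l)
    (c : Fin 28 → ℝ) {n : ℕ} {d : ℕ → ℝ} (hmono : ∀ j < n, d j < d (j + 1))
    (hflip : ∀ k ∈ M, ∃ i, 0 < i ∧ i < n ∧ d i = c k)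
    (hprefix : ∀ i < n, M.filter (fun k => c k ≤ d i) = ∅ ∨
      ∃ t ∈ M, M.filter (fun k => c k ≤ d i) = M.filter fun l => ρ t ≤ ρ l) :
    ∑ k ∈ M, (f (M.filter fun l => ρ k ≤ ρ l) - f (M.filter fun l => ρ k < ρ l)) * (-c k) =
      -∑ i ∈ Finset.Ico 1 n, d i *
        (f (M.filter fun k => c k ≤ d i) - f (M.filter fun k => c k ≤ d (i - 1))) := by
  classical
  obtain ⟨w, hw⟩ : ∃ w : Fin 28 → ℝ, ∀ k,
      w k = f (M.filter fun l => ρ k ≤ ρ l) - f (M.filter fun l => ρ k < ρ l) := ⟨_, fun _ => rfl⟩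
  obtain ⟨S, hS⟩ : ∃ S : ℕ → Finset (Fin 28), ∀ i, S i = M.filter fun k => c k ≤ d i := ⟨_, fun _ => rfl⟩
  simp only [← hw, ← hS]
  -- on prefix sets the greedy sums telescope exactly
  have hZ : ∀ i < n, ∑ k ∈ S i, w k = f (S i) - f ∅ := by
    intro i hi
    rcases hprefix i hi with h | ⟨t, ht, h⟩
    · rw [← hS] at h; rw [h]; simp
    · rw [← hS] at h; rw [h]
      have := greedy_sum_prefix f hgen t ht
      simp only [← hw] at this
      exact this
  have hre := sum_mul_eq_sum_chain_jumps M w c hmono hflip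
  simp only [← hS] at hre
  have hneg : ∑ k ∈ M, w k * -c k = -∑ i ∈ Finset.Ico 1 n, d i * (∑ k ∈ S i, w k - ∑ k ∈ S (i - 1), w k) := by
    rw [← hre, ← Finset.sum_neg_distrib]
    exact Finset.sum_congr rfl fun k _ => by ring
  rw [hneg, neg_inj]
  refine Finset.sum_congr rfl fun i hi => ?_
  obtain ⟨hi1, hin⟩ := Finset.mem_Ico.mp hi
  rw [hZ i hin, hZ (i - 1) (by omega)]
  ring

end Summit.KontsevichZagierPeriods.Zeta5Search.Barrier.ConeGamma

end
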